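import Summits.KontsevichZagierPeriods.KontsevichZagierPeriods.Theorems.HeckeMultiplicityOneManinStokesTileGeometry
import Summits.KontsevichZagierPeriods.KontsevichZagierPeriods.Theorems.HeckeMultiplicityOneManinStokesTileEdgeC

/-!
# `ManinStokes` (stmt-KontsevichZagierPeriods-5277): `j` maps the open tile onto the open lower half plane

Support file (prover-owned, `--supports stmt-KontsevichZagierPeriods-5277`). For the open `(2,3,∞)`-tile
`τ₀ = {0 < re z < 1/2, |z| > 1}` (half of Mathlib's open fundamental domain `𝒟ᵒ`):

* `isPreconnected_tile` — `τ₀` is connected (vertical rays plus a horizontal segment);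
* `kleinJ_im_ne_zero_of_mem_fdo` — on `𝒟ᵒ` off the imaginary axis `j` is not real;
* `kleinJ_quarter_add_two_I_im_neg` — `im j(1/4 + 2i) < 0` (cusp expansion), hence
  `kleinJ_im_neg_of_mem_tile` — **`im j < 0` on `τ₀`**, and `kleinJ_im_pos_of_mem_mirrorTile` — `im j > 0`
  on the mirror tile (`j(−z̄) = conj j(z)`);
* `exists_mem_tile_kleinJ_eq` — **every `u` with `im u < 0` is `j(z)` for some `z ∈ τ₀`**.

References: J.-P. Serre, *A Course in Arithmetic* (1973), VII §3.3; F. Diamond, J. Shurman, *A First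
Course in Modular Forms* (2005), §2.3–2.4. No definitions, no named facts.
-/

noncomputable section

open scoped MatrixGroups ModularForm Modular Manifold Topology
open CongruenceSubgroup Complex Set Filter MeasureTheory
open UpperHalfPlane hiding I
open Literature.NumberTheory.EllipticCurves Literature.NumberTheory.EllipticCurves.ModularForms

namespace Summit.KontsevichZagierPeriods.HeckeMultiplicityOne.ManinStokes

/-! ### The open tile `τ₀ = {0 < re z < 1/2, |z| > 1}` is connected -/

/-- Points `x + is` of `ℍ` written through `ofComplex`: coordinates. [folklore] -/
theorem coe_ofComplex_mk {x s : ℝ} (hs : 0 < s) :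
    ((ofComplex ((x : ℂ) + s * I) : ℍ) : ℂ) = (x : ℂ) + s * I :=
  coe_ofComplex (by simpa using hs)

/-- Real part of `ofComplex (x + is)`. [folklore] -/
theorem re_ofComplex_mk {x s : ℝ} (hs : 0 < s) : (ofComplex ((x : ℂ) + s * I) : ℍ).re = x := by
  rw [← UpperHalfPlane.coe_re, coe_ofComplex_mk hs]; simp

/-- Imaginary part of `ofComplex (x + is)`. [folklore] -/
theorem im_ofComplex_mk {x s : ℝ} (hs : 0 < s) : (ofComplex ((x : ℂ) + s * I) : ℍ).im = s := by
  rw [← UpperHalfPlane.coe_im, coe_ofComplex_mk hs]; simp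

/-- `normSq (x + is) = x² + s²` for the point `ofComplex (x + is)`. [folklore] -/
theorem normSq_ofComplex_mk {x s : ℝ} (hs : 0 < s) :
    Complex.normSq ((ofComplex ((x : ℂ) + s * I) : ℍ) : ℂ) = x ^ 2 + s ^ 2 := by
  rw [coe_ofComplex_mk hs, Complex.normSq_apply]; simp; ring

/-- Every point of `ℍ` is `ofComplex (re z + i im z)`. [folklore] -/
theorem eq_ofComplex_re_add_im (z : ℍ) : z = ofComplex ((z.re : ℂ) + z.im * I) := by
  apply UpperHalfPlane.ext
  rw [coe_ofComplex_mk z.im_pos]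
  apply Complex.ext <;> simp

/-- `s ↦ ofComplex (x + is)` is continuous on `(0, ∞)`. [folklore] -/
theorem continuousOn_ofComplex_mk (x : ℝ) :
    ContinuousOn (fun s : ℝ => (ofComplex ((x : ℂ) + s * I) : ℍ)) (Ioi 0) := by
  rw [UpperHalfPlane.isEmbedding_coe.continuousOn_iff]
  refine (show Continuous fun s : ℝ => (x : ℂ) + s * I by fun_prop).continuousOn.congr ?_
  intro s hs
  simp [Function.comp, coe_ofComplex_mk (show (0 : ℝ) < s from hs)]

/-- `x ↦ ofComplex (x + is)` is continuous for `s > 0`. [folklore] -/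
theorem continuous_ofComplex_mk_left {s : ℝ} (hs : 0 < s) :
    Continuous (fun x : ℝ => (ofComplex ((x : ℂ) + s * I) : ℍ)) := by
  rw [UpperHalfPlane.isEmbedding_coe.continuous_iff]
  refine (show Continuous fun x : ℝ => (x : ℂ) + s * I by fun_prop).congr ?_
  intro x
  simp [Function.comp, coe_ofComplex_mk hs]

/-- **The open tile `τ₀ = {0 < re z < 1/2, |z| > 1}` is preconnected**: any point is joined to
`1/4 + 2i` by its vertical ray followed by the horizontal segment at height `2`. [folklore] -/
theorem isPreconnected_tile :
    IsPreconnected {z : ℍ | 0 < z.re ∧ z.re < 1 / 2 ∧ 1 < Complex.normSq (z : ℂ)} := by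
  set T := {z : ℍ | 0 < z.re ∧ z.re < 1 / 2 ∧ 1 < Complex.normSq (z : ℂ)} with hT
  -- the horizontal segment at height 2
  set L : Set ℍ := (fun x : ℝ => (ofComplex ((x : ℂ) + (2 : ℝ) * I) : ℍ)) '' Ioo 0 (1 / 2) with hL
  have hLT : L ⊆ T := by
    rintro _ ⟨x, hx, rfl⟩
    refine ⟨by rw [re_ofComplex_mk two_pos]; exact hx.1, by rw [re_ofComplex_mk two_pos]; exact hx.2, ?_⟩
    rw [normSq_ofComplex_mk two_pos]; nlinarith [hx.1, hx.2]
  have hLc : IsPreconnected L :=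
    isPreconnected_Ioo.image _ (continuous_ofComplex_mk_left two_pos).continuousOn
  refine isPreconnected_of_forall (ofComplex (((1 / 4 : ℝ) : ℂ) + (2 : ℝ) * I)) fun y hy => ?_
  obtain ⟨hy0, hy1, hyn⟩ := hy
  -- the vertical ray through `y`
  set x := y.re with hx
  set R : Set ℍ := (fun s : ℝ => (ofComplex ((x : ℂ) + s * I) : ℍ)) '' Ioi (Real.sqrt (1 - x ^ 2))
    with hR
  have hsq0 : 0 ≤ Real.sqrt (1 - x ^ 2) := Real.sqrt_nonneg _
  have hRT : R ⊆ T := by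
    rintro _ ⟨s, hs, rfl⟩
    have hs0 : 0 < s := lt_of_le_of_lt hsq0 hs
    refine ⟨by rw [re_ofComplex_mk hs0]; exact hy0, by rw [re_ofComplex_mk hs0]; exact hy1, ?_⟩
    rw [normSq_ofComplex_mk hs0]
    have h1 : 1 - x ^ 2 < s ^ 2 := (Real.sqrt_lt' hs0).mp hs
    linarith
  have hRc : IsPreconnected R :=
    isPreconnected_Ioi.image _ ((continuousOn_ofComplex_mk x).mono fun s hs => lt_of_le_of_lt hsq0 hs)
  -- the two meet at `x + 2i`
  have hmeet : (ofComplex ((x : ℂ) + (2 : ℝ) * I) : ℍ) ∈ R ∩ L := by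
    refine ⟨⟨2, ?_, rfl⟩, ⟨x, ⟨hy0, hy1⟩, rfl⟩⟩
    have : Real.sqrt (1 - x ^ 2) ≤ 1 := Real.sqrt_le_one.mpr (by nlinarith)
    exact lt_of_le_of_lt this (by norm_num)
  refine ⟨R ∪ L, union_subset hRT hLT, Or.inr ⟨1 / 4, by norm_num, rfl⟩, Or.inl ?_, ?_⟩
  · refine ⟨y.im, ?_, (eq_ofComplex_re_add_im y).symm⟩
    rw [mem_Ioi, Real.sqrt_lt' y.im_pos]
    have : Complex.normSq (y : ℂ) = x ^ 2 + y.im ^ 2 := by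
      rw [Complex.normSq_apply, UpperHalfPlane.coe_re, UpperHalfPlane.coe_im]; ring
    linarith
  · exact hRc.union (ofComplex ((x : ℂ) + (2 : ℝ) * I)) hmeet.1 hmeet.2 hLc

/-! ### The sign of `im j` on the tile and its mirror image -/

/-- On the open fundamental domain off the imaginary axis `j` is not real: `j(z) ∈ ℝ` would give
`j(z) = j(−z̄)`, hence `−z̄ = ±z` in `𝒟ᵒ` (Mathlib `ModularGroup.eq_smul_self_of_mem_fdo_mem_fdo`). [folklore] -/
theorem kleinJ_im_ne_zero_of_mem_fdo {z : ℍ} (hz : z ∈ 𝒟ᵒ) (hre : z.re ≠ 0) : (kleinJ z).im ≠ 0 := by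
  intro him
  have hreal : kleinJ z = kleinJ (negConjPt z) := by
    rw [kleinJ_negConjPt]
    exact (Complex.conj_eq_iff_im.mpr him).symm
  obtain ⟨γ, hγ⟩ := kleinJ_eq_kleinJ_iff.mp hreal
  have hmem : negConjPt z ∈ 𝒟ᵒ := by
    refine ⟨?_, ?_⟩
    · rw [coe_negConjPt, Complex.normSq_neg, Complex.normSq_conj]; exact hz.1
    · have : (negConjPt z).re = -z.re := by
        rw [← UpperHalfPlane.coe_re, coe_negConjPt]; simp
      rw [this, abs_neg]; exact hz.2
  have heq := ModularGroup.eq_smul_self_of_mem_fdo_mem_fdo hz (hγ ▸ hmem)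
  rw [hγ] at heq
  have := congrArg UpperHalfPlane.re heq
  rw [← UpperHalfPlane.coe_re, ← UpperHalfPlane.coe_re (negConjPt z), coe_negConjPt] at this
  simp at this
  exact hre (by linarith)

/-- **A sample value**: `im j(1/4 + 2i) < 0` (`q = i e^{−4π}`, `j = 1/q + 744 + O(q)`,
`1/q = −i e^{4π}`). [folklore] -/
theorem kleinJ_quarter_add_two_I_im_neg :
    (kleinJ (ofComplex (((1 / 4 : ℝ) : ℂ) + (2 : ℝ) * I))).im < 0 := by
  set z : ℍ := ofComplex (((1 / 4 : ℝ) : ℂ) + (2 : ℝ) * I) with hz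
  set r : ℝ := Real.exp (-(2 * Real.pi * 2)) with hr
  have hr0 : 0 < r := Real.exp_pos _
  have hrle : r ≤ 1 / 10 ^ 4 := exp_neg_four_pi_le
  have hq : Function.Periodic.qParam 1 (z : ℂ) = (r : ℂ) * I := by
    rw [Function.Periodic.qParam, hz, coe_ofComplex_mk two_pos, Complex.ofReal_exp,
      show (2 * (Real.pi : ℂ) * I * (((1 / 4 : ℝ) : ℂ) + (2 : ℝ) * I) / ((1 : ℝ) : ℂ) : ℂ) =
        ((-(2 * Real.pi * 2) : ℝ) : ℂ) + (Real.pi / 2 : ℂ) * I by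
          push_cast; ring_nf; rw [Complex.I_sq]; ring,
      Complex.exp_add, Complex.exp_mul_I]
    have h1 : Complex.cos (Real.pi / 2 : ℂ) = 0 := by
      rw [show (Real.pi / 2 : ℂ) = ((Real.pi / 2 : ℝ) : ℂ) by push_cast; ring, ← Complex.ofReal_cos,
        Real.cos_pi_div_two]; simp
    have h2 : Complex.sin (Real.pi / 2 : ℂ) = 1 := by
      rw [show (Real.pi / 2 : ℂ) = ((Real.pi / 2 : ℝ) : ℂ) by push_cast; ring, ← Complex.ofReal_sin,
        Real.sin_pi_div_two]; simp
    rw [h1, h2]; ring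
  have hnorm : ‖Function.Periodic.qParam 1 (z : ℂ)‖ = r := by
    rw [hq, norm_mul, Complex.norm_I, mul_one, Complex.norm_real, Real.norm_of_nonneg hr0.le]
  have hest := norm_E₄_cube_div_discriminant_sub_sub_le z (by rw [hnorm]; exact hrle)
  rw [hnorm, hq] at hest
  change ‖kleinJ z - _ - 744‖ ≤ _ at hest
  have him : |(kleinJ z - ((r : ℂ) * I)⁻¹ - 744).im| ≤ 400000 * r :=
    (Complex.abs_im_le_norm _).trans hest
  have him' : (kleinJ z - ((r : ℂ) * I)⁻¹ - 744).im = (kleinJ z).im + r⁻¹ := by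
    have : ((r : ℂ) * I)⁻¹ = -((r⁻¹ : ℝ) : ℂ) * I := by
      rw [mul_inv, Complex.inv_I, Complex.ofReal_inv]; ring
    rw [this]; simp
  rw [him'] at him
  have h2 : (kleinJ z).im + r⁻¹ ≤ 400000 * r := (abs_le.mp him).2
  have h3 : 400000 * r ≤ 40 := by linarith
  have h4 : (10 : ℝ) ^ 4 ≤ r⁻¹ := by
    rw [le_inv_comm₀ (by norm_num) hr0]; simpa using hrle
  linarith

/-- **`im j < 0` on the open tile `τ₀`**: `im j` is continuous and never zero on the preconnected `τ₀`
(`kleinJ_im_ne_zero_of_mem_fdo`) and negative at `1/4 + 2i`. [folklore] -/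
theorem kleinJ_im_neg_of_mem_tile {z : ℍ} (hz : 0 < z.re ∧ z.re < 1 / 2 ∧ 1 < Complex.normSq (z : ℂ)) :
    (kleinJ z).im < 0 := by
  set T := {z : ℍ | 0 < z.re ∧ z.re < 1 / 2 ∧ 1 < Complex.normSq (z : ℂ)} with hT
  have hTfdo : ∀ w ∈ T, w ∈ 𝒟ᵒ := fun w hw => ⟨hw.2.2, by rw [abs_lt]; exact ⟨by linarith [hw.1], hw.2.1⟩⟩
  set z₀ : ℍ := ofComplex (((1 / 4 : ℝ) : ℂ) + (2 : ℝ) * I) with hz₀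
  have hz₀T : z₀ ∈ T := by
    refine ⟨by rw [hz₀, re_ofComplex_mk two_pos]; norm_num, by rw [hz₀, re_ofComplex_mk two_pos]; norm_num, ?_⟩
    rw [hz₀, normSq_ofComplex_mk two_pos]; norm_num
  have hcont : ContinuousOn (fun w : ℍ => (kleinJ w).im) T :=
    (Complex.continuous_im.comp continuous_kleinJ).continuousOn
  by_contra h
  rw [not_lt] at h
  -- `0 ∈ [im j(z₀), im j(z)] ⊆ im j '' T`
  have hsub := isPreconnected_tile.intermediate_value hz₀T hz hcont
  have h0 : (0 : ℝ) ∈ Icc ((kleinJ z₀).im) ((kleinJ z).im) := ⟨kleinJ_quarter_add_two_I_im_neg.le, h⟩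
  obtain ⟨w, hw, hw0⟩ := hsub h0
  exact kleinJ_im_ne_zero_of_mem_fdo (hTfdo w hw) (ne_of_gt hw.1) hw0

/-- **`im j > 0` on the mirror tile `τ₀* = {−1/2 < re z < 0, |z| > 1}`** (`j(−z̄) = conj j(z)`). [folklore] -/
theorem kleinJ_im_pos_of_mem_mirrorTile {z : ℍ}
    (hz : z.re < 0 ∧ -(1 / 2) < z.re ∧ 1 < Complex.normSq (z : ℂ)) : 0 < (kleinJ z).im := by
  have hre : (negConjPt z).re = -z.re := by rw [← UpperHalfPlane.coe_re, coe_negConjPt]; simp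
  have h := kleinJ_im_neg_of_mem_tile (z := negConjPt z)
    ⟨by rw [hre]; linarith [hz.1], by rw [hre]; linarith [hz.2.1],
      by rw [coe_negConjPt, Complex.normSq_neg, Complex.normSq_conj]; exact hz.2.2⟩
  rw [kleinJ_negConjPt, Complex.conj_im] at h
  linarith

/-- **Every `u` with `im u < 0` is `j(z)` for some `z` in the open tile `τ₀`.** Take any preimage
(`kleinJ_surjective`), move it to `𝒟` (`ModularGroup.exists_smul_mem_fd`); it is off the edges, where `j`
is real, and not in the mirror tile, where `im j > 0`. [cite: Serre1973, VII §3.3 Prop. 5] -/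
theorem exists_mem_tile_kleinJ_eq {u : ℂ} (hu : u.im < 0) :
    ∃ z : ℍ, (0 < z.re ∧ z.re < 1 / 2 ∧ 1 < Complex.normSq (z : ℂ)) ∧ kleinJ z = u := by
  obtain ⟨z₀, hz₀⟩ := kleinJ_surjective u
  obtain ⟨γ, hγ⟩ := ModularGroup.exists_smul_mem_fd z₀
  set z := γ • z₀ with hz
  have hj : kleinJ z = u := by rw [hz, kleinJ_smul, hz₀]
  have hne : (kleinJ z).im ≠ 0 := by rw [hj]; exact hu.ne
  have hre2 : |z.re| < 1 / 2 := by
    refine lt_of_le_of_ne hγ.2 fun h => hne ?_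
    rcases (abs_eq (by norm_num : (0 : ℝ) ≤ 1 / 2)).mp h with h' | h'
    · exact kleinJ_im_eq_zero z (k := 1) (by rw [h']; norm_num)
    · exact kleinJ_im_eq_zero z (k := -1) (by rw [h']; norm_num)
  have hnorm : 1 < Complex.normSq (z : ℂ) := by
    refine lt_of_le_of_ne hγ.1 fun h => hne (kleinJ_im_eq_zero_of_norm_eq_one ?_)
    have h2 : ‖(z : ℂ)‖ ^ 2 = 1 := by rw [← Complex.normSq_eq_norm_sq]; exact h.symm
    exact (pow_eq_one_iff_of_nonneg (norm_nonneg _) two_ne_zero).mp h2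
  have hre0 : z.re ≠ 0 := fun h => hne (kleinJ_im_eq_zero z (k := 0) (by rw [h]; norm_num))
  rcases lt_or_gt_of_ne hre0 with hneg | hpos
  · exfalso
    have := kleinJ_im_pos_of_mem_mirrorTile ⟨hneg, (abs_lt.mp hre2).1, hnorm⟩
    rw [hj] at this
    exact lt_asymm hu this
  · exact ⟨z, ⟨hpos, (abs_lt.mp hre2).2, hnorm⟩, hj⟩


end Summit.KontsevichZagierPeriods.HeckeMultiplicityOne.ManinStokes
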